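import Summits.BirchSwinnertonDyer.BirchSwinnertonDyer.Theses.LeadingTerm
import Summits.BirchSwinnertonDyer.BirchSwinnertonDyer.Theorems.PAdicOrderV2PadicBSDrankLevelZero
import Literature.NumberTheory.EllipticCurves.IwasawaLeadingTerm
import Literature.NumberTheory.EllipticCurves.IwasawaOrderOfVanishing
import Literature.NumberTheory.EllipticCurves.QuadraticTwistRank

/-!
# Crux `Consistency` (stmt-BirchSwinnertonDyer-16217) — ideation sketch, round 1, ideator 1

First lemmas of the two crux idea cards filed by `planner-cruxidea-stmt-BirchSwinnertonDyer-16217-1-0`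
(they only have to ELABORATE; the anatomy theorems below are in addition kernel-checked):

* card `schneider-kato-locus-split` — `BadLocusVanishing` (first lemma: the `p`-adic clause of the
  crux is AUTOMATIC off the regular locus `{Reg_p ≠ 0 ∧ #Ш[p^∞] < ∞}`), proved here from the named
  facts `Schneider1985_order_charGenerator` + `kato_divisibility` (`badLocusVanishing_of_facts`), and
  the NECESSITY theorem `shaTransfer_of_consistency` : `BadLocusVanishing → Consistency → ShaTransfer`
  (any proof of the crux proves finiteness of `Ш[p^∞]` at every non-degenerate good ordinary prime of
  every curve with `L^{(r_MW)}(E,1) ≠ 0` — an ∞ → p non-vanishing transfer, open from rank 2 on);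
* card `plectic-twist-to-rank-zero` — `RealQuadraticTwistSupply` (first lemma: a real quadratic
  field `F = ℚ(√d)` with `L(E^{(d)},1) ≠ 0` and `p` inert, Friedberg–Hoffstein / Waldspurger), the
  entrance of the plectic bidegree-(1,1) line for the first open cell `r_MW = r_an = 2`.
-/

noncomputable section

open scoped Classical

namespace Summit.BirchSwinnertonDyer.BirchSwinnertonDyer.Cruxes.Consistency.IdeasR1K1

open Literature.NumberTheory.EllipticCurves WeierstrassCurve
open Summit.BirchSwinnertonDyer.BirchSwinnertonDyer.Theses.LeadingTerm

/-! ## Card `schneider-kato-locus-split` -/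

/-- **Bad-locus vanishing** (first lemma of card `schneider-kato-locus-split`): at a good ordinary
`p ≥ 5`, if the canonical cyclotomic height is DEGENERATE (`Reg_p(D) = 0`) or `Ш(E)[p^∞]` is
INFINITE, then the rank-indexed coefficient `[T^{r_MW}] L_p(E,T)` vanishes — so the `p`-adic clause
of `Consistency` holds there with ANY `q` times `Reg_p`… more precisely it forces `q · Reg_p = 0`.
Provable now from Schneider 1985 (clauses 1–2: `ord_T f_E ≥ r`, `= r ↔ nondeg ∧ Ш(p) finite`) and
Kato's divisibility `f_E ∣ p^n L_p` (`badLocusVanishing_of_facts`). -/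
def BadLocusVanishing : Prop :=
  ∀ (W : WeierstrassCurve ℚ) [W.IsElliptic] [W.IsGloballyMinimal] (p : ℕ) [Fact p.Prime], 5 ≤ p →
    IsOrdinaryAt W p → ∀ (D : WeierstrassCurve.PAdicHeightData W p), D.IsCanonical →
    ∀ ⦃N : ℕ⦄ [NeZero N] (f : CuspForm (CongruenceSubgroup.Gamma0 N) 2),
    ModularForms.IsNewformOf W f →
    (WeierstrassCurve.padicRegulator D = 0 ∨ ¬ Finite (AddCommGroup.primaryComponent W.sha p)) →
    PowerSeries.coeff W.mordellWeilRank (padicLFunction f (unitRoot W p : ℚ_[p])) = 0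

/-- **Ш-transfer (∞ → p)**: non-vanishing of the RANK-INDEXED archimedean Taylor coefficient
`L^{(r_MW)}(E,1)` together with non-degeneracy of the canonical cyclotomic `p`-adic height forces
finiteness of `Ш(E)[p^∞]` (at a good ordinary `p ≥ 5`, newform `f` of `E` given). Known for
`r_MW ≤ 1` (Kolyvagin, Kato); OPEN from `r_MW = 2` on (no `Ш`-finiteness theorem at any prime for any
curve of analytic rank `≥ 2`, SelmerRankBarrier). NECESSARY for the crux:
`shaTransfer_of_consistency`. -/
def ShaTransfer : Prop :=
  ∀ (W : WeierstrassCurve ℚ) [W.IsElliptic] [W.IsGloballyMinimal] (p : ℕ) [Fact p.Prime], 5 ≤ p →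
    IsOrdinaryAt W p → ∀ (D : WeierstrassCurve.PAdicHeightData W p), D.IsCanonical →
    ∀ ⦃N : ℕ⦄ [NeZero N] (f : CuspForm (CongruenceSubgroup.Gamma0 N) 2),
    ModularForms.IsNewformOf W f →
    iteratedDeriv W.mordellWeilRank W.entireLFunction 1 ≠ 0 →
    WeierstrassCurve.padicRegulator D ≠ 0 →
    Finite (AddCommGroup.primaryComponent W.sha p)

/-- **Necessity of the Ш-transfer.** Given bad-locus vanishing (a theorem relative to Schneider +
Kato, below), the crux `Consistency` implies `ShaTransfer`: if `Ш[p^∞]` were infinite then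
`[T^r] L_p = 0`, so `q · (1 - α⁻¹)² · Reg_p = 0`; `1 - α⁻¹ ≠ 0` at a good ordinary prime
(`levelZero_one_sub_unitRoot_inv_ne_zero`, MTT §I.14) and `Reg_p ≠ 0` give `q = 0`, whence the
archimedean clause reads `L^{(r_MW)}(E,1) = 0` — contradiction. -/
theorem shaTransfer_of_consistency (hbad : BadLocusVanishing) (hC : Consistency) : ShaTransfer := by
  intro W _ _ p _ hp hord D hD N _ f hf hL hReg
  by_contra hinf
  have h0 := hbad W p hp hord D hD f hf (Or.inr hinf)
  obtain ⟨-, -, q, hA, hP⟩ := hC W p hp hord D hD f hf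
  rw [h0, zero_mul] at hP
  have hε := Summit.BirchSwinnertonDyer.BirchSwinnertonDyer.Theorems.levelZero_one_sub_unitRoot_inv_ne_zero
    W p hord
  have hq : (q : ℚ_[p]) = 0 := by
    rcases mul_eq_zero.mp hP.symm with h | h
    · rcases mul_eq_zero.mp h with h' | h'
      · exact h'
      · exact absurd h' (pow_ne_zero _ hε)
    · exact absurd h hReg
  have hq' : q = 0 := by exact_mod_cast hq
  apply hL
  rw [hA, hq']
  push_cast
  ring

/-- **Bad-locus vanishing from the named facts** `Schneider1985_order_charGenerator` (Schneider 1985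
as printed by Balakrishnan–Müller–Stein 2016, Thm. 1.7) and `kato_divisibility` (Kato 2004,
Thm. 17.4), with the proved tree theorems supplying the normalised cyclotomic pair
(`exists_isCyclotomic_isTopGenerator_isCyclotomicVariable_holds`), the Iwasawa module
(`selmerDualData`), its finite generation (`module_finite_of_isCyclotomic`) and principality of its
characteristic ideal (`charIdeal_isPrincipal_holds`). Degenerate height or infinite `Ш(p)` ⇒
`ord_T f_E ≠ r` ⇒ `ord_T f_E ≥ r + 1` ⇒ `T^{r+1} ∣ f_E ∣ g`, `ι g = p^n L_p` ⇒ `[T^r] L_p = 0`. -/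
theorem badLocusVanishing_of_facts
    (hS : Schneider1985_order_charGenerator)
    (hkato : ∀ (W : WeierstrassCurve ℚ) [W.IsElliptic] [W.IsGloballyMinimal] (p : ℕ) [Fact p.Prime]
      {N : ℕ} [NeZero N] {f : CuspForm (CongruenceSubgroup.Gamma0 N) 2} (κ : ZpExtension ℚ p)
      (γ : Field.absoluteGaloisGroup ℚ), kato_divisibility W p (κ := κ) (γ := γ) (f := f)) :
    BadLocusVanishing := by
  intro W _ _ p _ hp hord D hD N _ f hf hbad
  have hp2 : p ≠ 2 := by omega
  obtain ⟨κ, hκ, γ, hγ, hγ'⟩ := exists_isCyclotomic_isTopGenerator_isCyclotomicVariable_holds p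
  set X := W.selmerDualData κ hγ with hXdef
  haveI : Module.Finite (IwasawaAlgebra p) X.X := X.module_finite_of_isCyclotomic W κ hκ hγ
  obtain ⟨hXtors, ⟨n, g, hg, hιg⟩, -⟩ := hkato W p κ γ hp2 hord hκ hγ hγ' hf X
  have hprin : (X.charIdeal).IsPrincipal := charIdeal_isPrincipal_holds p X.X
  obtain ⟨fE, hfE⟩ := hprin.principal
  have hfE' : X.charIdeal = Ideal.span {fE} := hfE
  obtain ⟨hle, hiff, -⟩ := hS W p hp hord.1 hord.2 κ γ hκ hγ hγ' X hXtors fE hfE' D hD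
  -- off the regular locus the order of vanishing of `f_E` exceeds the rank
  have hne : fE.order ≠ W.mordellWeilRank := by
    intro heq
    obtain ⟨hSch, hfin⟩ := hiff.mp heq
    rcases hbad with h | h
    · exact hSch h
    · exact h hfin
  have hlt : (W.mordellWeilRank : ℕ∞) < fE.order := lt_of_le_of_ne hle (Ne.symm hne)
  have hle' : ((W.mordellWeilRank + 1 : ℕ) : ℕ∞) ≤ fE.order := by
    rw [Nat.cast_add, Nat.cast_one]
    exact Order.add_one_le_of_lt hlt
  have hdvd : (PowerSeries.X : IwasawaAlgebra p) ^ (W.mordellWeilRank + 1) ∣ fE :=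
    PowerSeries.X_pow_dvd_iff.mpr fun m hm =>
      PowerSeries.coeff_of_lt_order m (lt_of_lt_of_le (by exact_mod_cast hm) hle')
  -- `g ∈ (fE)` so `T^{r+1} ∣ g`, and `ι g = p^n · L_p`
  have hg' : fE ∣ g := by
    rw [hfE'] at hg
    exact Ideal.mem_span_singleton.mp hg
  have hdvdg : (PowerSeries.X : IwasawaAlgebra p) ^ (W.mordellWeilRank + 1) ∣ g := hdvd.trans hg'
  have hdvdι : (PowerSeries.X : PowerSeries ℚ_[p]) ^ (W.mordellWeilRank + 1) ∣
      PowerSeries.C ((p : ℚ_[p]) ^ n) * padicLFunction f (unitRoot W p : ℚ_[p]) := by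
    rw [← hιg]
    have := map_dvd (iwasawaToPowerSeries p) hdvdg
    simpa [map_pow, PowerSeries.map_X] using this
  have hcoeff := (PowerSeries.X_pow_dvd_iff.mp hdvdι) W.mordellWeilRank (Nat.lt_succ_self _)
  rw [PowerSeries.coeff_C_mul] at hcoeff
  have hpn : ((p : ℚ_[p]) ^ n) ≠ 0 := pow_ne_zero _ (by exact_mod_cast (Fact.out : p.Prime).ne_zero)
  exact (mul_eq_zero.mp hcoeff).resolve_left hpn

/-- Packaging: relative to the two deep named facts the crux implies the Ш-transfer outright. -/
theorem shaTransfer_of_consistency_of_facts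
    (hS : Schneider1985_order_charGenerator)
    (hkato : ∀ (W : WeierstrassCurve ℚ) [W.IsElliptic] [W.IsGloballyMinimal] (p : ℕ) [Fact p.Prime]
      {N : ℕ} [NeZero N] {f : CuspForm (CongruenceSubgroup.Gamma0 N) 2} (κ : ZpExtension ℚ p)
      (γ : Field.absoluteGaloisGroup ℚ), kato_divisibility W p (κ := κ) (γ := γ) (f := f))
    (hC : Consistency) : ShaTransfer :=
  shaTransfer_of_consistency (badLocusVanishing_of_facts hS hkato) hC

/-- **Regular-locus core** (the honest residue of the crux under the locus split): on the locus
`Reg_p(D) ≠ 0 ∧ #Ш[p^∞] < ∞` the crux is the EXACT rank-`r_MW` `p`-adic Beilinson identity with a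
rational constant `q = L^{(r)}(E,1)/(r!·Ω⁺_f·Reg_∞)` (Burns–Kurihara–Sano's Generalized
Perrin-Riou conjecture `mrs2` under their Hypothesis 2.2, via the Generalized Rubin Formula,
arXiv:1910.07404 Thm. 6.2 / Cor. 6.7). Stated here as the restriction of the crux to that locus;
`consistency_of_locusSplit` glues it with `BadLocusVanishing` and the vanishing of
`L^{(r_MW)}(E,1)` off the locus (`OffLocusArchimedeanVanishing`). -/
def RegularLocusCore : Prop :=
  ∀ (W : WeierstrassCurve ℚ) [W.IsElliptic] [W.IsGloballyMinimal] (p : ℕ) [Fact p.Prime], 5 ≤ p →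
    IsOrdinaryAt W p → ∀ (D : WeierstrassCurve.PAdicHeightData W p), D.IsCanonical →
    ∀ ⦃N : ℕ⦄ [NeZero N] (f : CuspForm (CongruenceSubgroup.Gamma0 N) 2),
    ModularForms.IsNewformOf W f →
    WeierstrassCurve.padicRegulator D ≠ 0 → Finite (AddCommGroup.primaryComponent W.sha p) →
    0 < W.regulator ∧ 0 < ModularForms.plusPeriod f ∧
    ∃ q : ℚ, iteratedDeriv W.mordellWeilRank W.entireLFunction 1 =
        (((W.mordellWeilRank.factorial : ℝ) * (q : ℝ) * ModularForms.plusPeriod f * W.regulator : ℝ) : ℂ) ∧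
      PowerSeries.coeff W.mordellWeilRank (padicLFunction f (unitRoot W p : ℚ_[p])) *
          padicLog p (cyclotomicGenerator p) ^ W.mordellWeilRank =
        (q : ℚ_[p]) * (1 - (unitRoot W p : ℚ_[p])⁻¹) ^ 2 * WeierstrassCurve.padicRegulator D

/-- **Off-locus archimedean clause**: off the regular locus the crux needs EITHER `Reg_p = 0` (then
the `p`-adic clause is `0 = 0` and only rationality `L^{(r)}/(r!Ω⁺Reg_∞) ∈ ℚ` remains — clause
(A′)) OR, when `Reg_p ≠ 0` and `Ш[p^∞]` is infinite, the VANISHING `L^{(r_MW)}(E,1) = 0` (=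
`ShaTransfer` contraposed). Both packaged with the well-definedness conjuncts. -/
def OffLocusArchimedean : Prop :=
  ∀ (W : WeierstrassCurve ℚ) [W.IsElliptic] [W.IsGloballyMinimal] (p : ℕ) [Fact p.Prime], 5 ≤ p →
    IsOrdinaryAt W p → ∀ (D : WeierstrassCurve.PAdicHeightData W p), D.IsCanonical →
    ∀ ⦃N : ℕ⦄ [NeZero N] (f : CuspForm (CongruenceSubgroup.Gamma0 N) 2),
    ModularForms.IsNewformOf W f →
    (WeierstrassCurve.padicRegulator D = 0 ∨ ¬ Finite (AddCommGroup.primaryComponent W.sha p)) →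
    0 < W.regulator ∧ 0 < ModularForms.plusPeriod f ∧
    ∃ q : ℚ, iteratedDeriv W.mordellWeilRank W.entireLFunction 1 =
        (((W.mordellWeilRank.factorial : ℝ) * (q : ℝ) * ModularForms.plusPeriod f * W.regulator : ℝ) : ℂ) ∧
      (WeierstrassCurve.padicRegulator D ≠ 0 → q = 0)

/-- **Locus-split glue** (kernel-checked): `BadLocusVanishing → OffLocusArchimedean →
RegularLocusCore → Consistency`. -/
theorem consistency_of_locusSplit (hbad : BadLocusVanishing) (hoff : OffLocusArchimedean)
    (hcore : RegularLocusCore) : Consistency := by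
  intro W _ _ p _ hp hord D hD N _ f hf
  by_cases hloc : WeierstrassCurve.padicRegulator D ≠ 0 ∧ Finite (AddCommGroup.primaryComponent W.sha p)
  · exact hcore W p hp hord D hD f hf hloc.1 hloc.2
  · have hbad' : WeierstrassCurve.padicRegulator D = 0 ∨
        ¬ Finite (AddCommGroup.primaryComponent W.sha p) := by
      by_cases hR : WeierstrassCurve.padicRegulator D = 0
      · exact Or.inl hR
      · exact Or.inr fun hfin => hloc ⟨hR, hfin⟩
    have h0 := hbad W p hp hord D hD f hf hbad'
    obtain ⟨hreg, hΩ, q, hA, hq⟩ := hoff W p hp hord D hD f hf hbad'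
    refine ⟨hreg, hΩ, q, hA, ?_⟩
    rw [h0, zero_mul]
    rcases hbad' with hR | hinf
    · rw [hR]; ring
    · by_cases hR : WeierstrassCurve.padicRegulator D = 0
      · rw [hR]; ring
      · rw [hq hR]; push_cast; ring

/-! ## Card `plectic-twist-to-rank-zero` -/

/-- **Real-quadratic twist supply** (first lemma of card `plectic-twist-to-rank-zero`): for `E/ℚ`
of EVEN analytic rank (root number `+1`) and a prime `p`, there is a square-free `d > 1`, prime to
`p` and a NON-residue mod `p` (so `p` is inert in `F = ℚ(√d)`, real quadratic), with
`L(E^{(d)}, 1) ≠ 0`. Printed: Friedberg–Hoffstein, Ann. of Math. 142 (1995), Thm. B (quadratic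
twists with prescribed local components at finitely many places are non-vanishing infinitely often
when the forced sign is `+1`; here `χ_d` trivial at every `ℓ ∣ N`, `χ_d(-1) = +1`, `χ_d(p) = -1`
keeps `w(E ⊗ χ_d) = w(E) · χ_d(-N) = +1`); Waldspurger 1991 Thm. 4. Then `L(E/F,s) =
L(E,s)·L(E^{(d)},s)` has `ord_{s=1} = r_an(E)`, `rank E(F) = rank E(ℚ)` (`E^{(d)}(ℚ)` finite by
Kato/Kolyvagin) and `Ê(F_p) ⊗ ℚ_p` has `ℤ_p`-rank 2 — the plectic bidegree-(1,1) entrance. -/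
def RealQuadraticTwistSupply : Prop :=
  ∀ (W : WeierstrassCurve ℚ) [W.IsElliptic] (p : ℕ) [Fact p.Prime], Even W.analyticRank →
    ∃ d : ℕ, 1 < d ∧ Squarefree d ∧ ¬ p ∣ d ∧ ¬ IsSquare ((d : ℤ) : ZMod p) ∧
      (W.quadraticTwist (d : ℚ)).entireLFunction 1 ≠ 0

/-- Bookkeeping used by the plectic line (tree theorem, recorded as an `example`): over a quadratic
field `K`, `rank E(K) = rank E(ℚ) + rank E^{(d_K)}(ℚ)`. -/
example (W : WeierstrassCurve ℚ) (K : Type) [Field K] [NumberField K]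
    (h2 : Module.finrank ℚ K = 2) [Module.Finite ℤ (W.baseChange K).toAffine.Point] :
    (W.baseChange K).mordellWeilRank =
      W.mordellWeilRank + (W.quadraticTwist (NumberField.discr K : ℚ)).mordellWeilRank :=
  W.mordellWeilRank_baseChange_of_finrank_eq_two_of_finite K h2

end Summit.BirchSwinnertonDyer.BirchSwinnertonDyer.Cruxes.Consistency.IdeasR1K1

end
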